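import Mathlib
import Summits.Ventures.PercRepro2.ReimerCells

/-!
# The union Reimer / three-point inequality for arbitrary edge probabilities (PercRepro2, mine-1)

Product weights `w S = ∏_{i ∈ U} (if i ∈ S then p i else 1 - p i)` with `0 ≤ p i ≤ 1`.  On a cell
`(K, α)` of the decomposition `card_pairs_eq_sum_cells` the weight `w (α ∪ γ) · w (α ∪ ((U \ K) \ γ))`
does not depend on `γ` (every `i ∉ K` is open in exactly one of the two configurations), so the
counting inequality of `reimer_union_decr` on the sub-cube lifts verbatim:

  `(∑_{S : (E₁□F₁ ∨ E₂□F₂) ∧ D} w S) · (∑_T w T) ≤ ∑_{(S,T) : ((E₁ S ∧ F₁ T) ∨ (E₂ S ∧ F₂ T)) ∧ D S} w S · w T`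

(`bk_union_decr_weighted`), i.e. `P_p((E₁∘F₁ ∪ E₂∘F₂) ∩ D) ≤ P_p((E₁∩D)×F₁ ∪ (E₂∩D)×F₂)` for every
product measure — MINE-1.md Corollary 16.8 in full generality (`three_point_weighted`:
`P_p((A∩C)∘B ∪ A∘(B∩C)) + P_p(A∩C)P_p(B∩C) ≤ P_p(A∩C)P_p(B) + P_p(A)P_p(B∩C)`).
-/

namespace Summit.Ventures.PercRepro2

namespace ReimerCube

variable {E : Type*} [DecidableEq E]

/-- The product weight of a configuration `S ⊆ U` with edge probabilities `p`. -/
def wt (U : Finset E) (p : E → ℝ) (S : Finset E) : ℝ :=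
  ∏ i ∈ U, (if i ∈ S then p i else 1 - p i)

/-- Product weights are non-negative for `0 ≤ p ≤ 1`. -/
lemma wt_nonneg (U : Finset E) (p : E → ℝ) (hp : ∀ i, 0 ≤ p i ∧ p i ≤ 1) (S : Finset E) :
    0 ≤ wt U p S := by
  unfold wt
  apply Finset.prod_nonneg
  intro i _
  split_ifs
  · exact (hp i).1
  · linarith [(hp i).2]

/-- The cell weight: on the cell `(K, α)` the product `wt (α ∪ γ) * wt (α ∪ ((U \ K) \ γ))` equals
`∏_{i ∈ K} (if i ∈ α then p i else 1 - p i)^2 · ∏_{i ∈ U \ K} p i (1 - p i)`, independently of `γ`. -/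
lemma wt_cell (U K α γ : Finset E) (p : E → ℝ) (hα : α ⊆ K) (hγ : γ ⊆ U \ K) :
    wt U p (α ∪ γ) * wt U p (α ∪ ((U \ K) \ γ))
      = ∏ i ∈ U, (if i ∈ K then (if i ∈ α then p i else 1 - p i) ^ 2 else p i * (1 - p i)) := by
  unfold wt
  rw [← Finset.prod_mul_distrib]
  apply Finset.prod_congr rfl
  intro i hi
  by_cases hiK : i ∈ K
  · have h1 : i ∉ γ := fun h => (Finset.mem_sdiff.mp (hγ h)).2 hiK
    have h2 : i ∉ (U \ K) \ γ := fun h => (Finset.mem_sdiff.mp (Finset.mem_sdiff.mp h).1).2 hiK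
    have e1 : (i ∈ α ∪ γ) ↔ i ∈ α := by
      rw [Finset.mem_union]; exact ⟨fun h => h.resolve_right h1, Or.inl⟩
    have e2 : (i ∈ α ∪ ((U \ K) \ γ)) ↔ i ∈ α := by
      rw [Finset.mem_union]; exact ⟨fun h => h.resolve_right h2, Or.inl⟩
    simp only [hiK, if_true]
    by_cases hiα : i ∈ α
    · rw [if_pos (e1.mpr hiα), if_pos (e2.mpr hiα), if_pos hiα]; ring
    · rw [if_neg (fun h => hiα (e1.mp h)), if_neg (fun h => hiα (e2.mp h)), if_neg hiα]; ring
  · have hiα : i ∉ α := fun h => hiK (hα h)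
    have hiI : i ∈ U \ K := Finset.mem_sdiff.mpr ⟨hi, hiK⟩
    simp only [hiK, if_false]
    by_cases hiγ : i ∈ γ
    · have e1 : i ∈ α ∪ γ := Finset.mem_union_right _ hiγ
      have e2 : i ∉ α ∪ ((U \ K) \ γ) := by
        rw [Finset.mem_union, not_or]
        exact ⟨hiα, fun h => (Finset.mem_sdiff.mp h).2 hiγ⟩
      rw [if_pos e1, if_neg e2]
    · have e1 : i ∉ α ∪ γ := by
        rw [Finset.mem_union, not_or]; exact ⟨hiα, hiγ⟩
      have e2 : i ∈ α ∪ ((U \ K) \ γ) := Finset.mem_union_right _ (Finset.mem_sdiff.mpr ⟨hiI, hiγ⟩)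
      rw [if_neg e1, if_pos e2]; ring

open Classical in
/-- The sum version of the cell decomposition (`card_pairs_eq_sum_cells` with a summand). -/
lemma sum_pairs_eq_sum_cells (U : Finset E) (Q : Finset E → Finset E → Prop)
    [DecidablePred (fun p : Finset E × Finset E => Q p.1 p.2)]
    [∀ K α : Finset E, DecidablePred (fun γ => Q (α ∪ γ) (α ∪ ((U \ K) \ γ)))]
    (f : Finset E → Finset E → ℝ) :
    ∑ q ∈ (U.powerset ×ˢ U.powerset).filter (fun p => Q p.1 p.2), f q.1 q.2
      = ∑ K ∈ U.powerset, ∑ α ∈ K.powerset,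
          ∑ γ ∈ (U \ K).powerset.filter (fun γ => Q (α ∪ γ) (α ∪ ((U \ K) \ γ))),
            f (α ∪ γ) (α ∪ ((U \ K) \ γ)) := by
  have hsig : ∑ K ∈ U.powerset, ∑ α ∈ K.powerset,
        ∑ γ ∈ (U \ K).powerset.filter (fun γ => Q (α ∪ γ) (α ∪ ((U \ K) \ γ))),
          f (α ∪ γ) (α ∪ ((U \ K) \ γ))
      = ∑ x ∈ (U.powerset.sigma (fun K => K.powerset.sigma
          (fun α => (U \ K).powerset.filter (fun γ => Q (α ∪ γ) (α ∪ ((U \ K) \ γ)))))),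
          f (x.2.1 ∪ x.2.2) (x.2.1 ∪ ((U \ x.1) \ x.2.2)) := by
    rw [Finset.sum_sigma]
    apply Finset.sum_congr rfl
    intro K _
    rw [Finset.sum_sigma]
  rw [hsig]
  symm
  apply Finset.sum_nbij' (fun x => (x.2.1 ∪ x.2.2, x.2.1 ∪ ((U \ x.1) \ x.2.2)))
    (fun q => ⟨U.filter (fun i => i ∈ q.1 ↔ i ∈ q.2), q.1 ∩ U.filter (fun i => i ∈ q.1 ↔ i ∈ q.2),
      q.1 \ U.filter (fun i => i ∈ q.1 ↔ i ∈ q.2)⟩)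
  · -- maps into
    rintro ⟨K, α, γ⟩ hx
    simp only [Finset.mem_sigma, Finset.mem_powerset, Finset.mem_filter] at hx
    obtain ⟨hK, hα, hγ, hQ⟩ := hx
    simp only [Finset.mem_filter, Finset.mem_product, Finset.mem_powerset]
    exact ⟨⟨Finset.union_subset (hα.trans hK) (hγ.trans Finset.sdiff_subset),
      Finset.union_subset (hα.trans hK) (Finset.sdiff_subset.trans Finset.sdiff_subset)⟩, hQ⟩
  · -- inverse maps into
    rintro ⟨S, T⟩ hp
    simp only [Finset.mem_filter, Finset.mem_product, Finset.mem_powerset] at hp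
    obtain ⟨⟨hS, hT⟩, hQ⟩ := hp
    simp only [Finset.mem_sigma, Finset.mem_powerset, Finset.mem_filter]
    refine ⟨Finset.filter_subset _ _, Finset.inter_subset_right, ?_, ?_⟩
    · intro i hi
      rw [Finset.mem_sdiff] at hi ⊢
      exact ⟨hS hi.1, hi.2⟩
    · have e1 : S ∩ U.filter (fun i => i ∈ S ↔ i ∈ T) ∪ S \ U.filter (fun i => i ∈ S ↔ i ∈ T) = S := by
        ext i
        simp only [Finset.mem_union, Finset.mem_inter, Finset.mem_sdiff]
        tauto
      have e2 : S ∩ U.filter (fun i => i ∈ S ↔ i ∈ T)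
          ∪ ((U \ U.filter (fun i => i ∈ S ↔ i ∈ T)) \ (S \ U.filter (fun i => i ∈ S ↔ i ∈ T))) = T := by
        ext i
        simp only [Finset.mem_union, Finset.mem_inter, Finset.mem_sdiff, Finset.mem_filter]
        have hSU : i ∈ S → i ∈ U := fun h => hS h
        have hTU : i ∈ T → i ∈ U := fun h => hT h
        tauto
      rw [e1, e2]
      exact hQ
  · -- left inverse
    rintro ⟨K, α, γ⟩ hx
    simp only [Finset.mem_sigma, Finset.mem_powerset, Finset.mem_filter] at hx
    obtain ⟨hK, hα, hγ, -⟩ := hx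
    have hKeq : U.filter (fun i => i ∈ α ∪ γ ↔ i ∈ α ∪ ((U \ K) \ γ)) = K := by
      ext i
      simp only [Finset.mem_filter, Finset.mem_union, Finset.mem_sdiff]
      constructor
      · rintro ⟨hiU, h⟩
        by_contra hiK
        have hiα : i ∉ α := fun h' => hiK (hα h')
        by_cases hiγ : i ∈ γ
        · have := h.mp (Or.inr hiγ)
          rcases this with h' | h'
          · exact hiα h'
          · exact h'.2 hiγ
        · have := h.mpr (Or.inr ⟨⟨hiU, hiK⟩, hiγ⟩)
          rcases this with h' | h'
          · exact hiα h'
          · exact hiγ h'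
      · intro hiK
        refine ⟨hK hiK, ?_⟩
        have h1 : i ∉ γ := fun h => (Finset.mem_sdiff.mp (hγ h)).2 hiK
        constructor
        · rintro (h | h)
          · exact Or.inl h
          · exact absurd h h1
        · rintro (h | h)
          · exact Or.inl h
          · exact absurd hiK h.1.2
    have hαeq : (α ∪ γ) ∩ K = α := by
      ext i
      simp only [Finset.mem_inter, Finset.mem_union]
      constructor
      · rintro ⟨h | h, hiK⟩
        · exact h
        · exact absurd hiK (Finset.mem_sdiff.mp (hγ h)).2
      · intro h
        exact ⟨Or.inl h, hα h⟩
    have hγeq : (α ∪ γ) \ K = γ := by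
      ext i
      simp only [Finset.mem_sdiff, Finset.mem_union]
      constructor
      · rintro ⟨h | h, hiK⟩
        · exact absurd (hα h) hiK
        · exact h
      · intro h
        exact ⟨Or.inr h, (Finset.mem_sdiff.mp (hγ h)).2⟩
    simp only [hKeq, hαeq, hγeq]
  · -- right inverse
    rintro ⟨S, T⟩ hp
    simp only [Finset.mem_filter, Finset.mem_product, Finset.mem_powerset] at hp
    obtain ⟨⟨hS, hT⟩, -⟩ := hp
    simp only [Prod.mk.injEq]
    constructor
    · ext i
      simp only [Finset.mem_union, Finset.mem_inter, Finset.mem_sdiff]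
      tauto
    · ext i
      simp only [Finset.mem_union, Finset.mem_inter, Finset.mem_sdiff, Finset.mem_filter]
      have hSU : i ∈ S → i ∈ U := fun h => hS h
      have hTU : i ∈ T → i ∈ U := fun h => hT h
      tauto
  · -- the summand agrees
    rintro ⟨K, α, γ⟩ _
    rfl

open Classical in
/-- **Union Reimer for arbitrary edge probabilities (two-copy form).**  For `0 ≤ p ≤ 1`, increasing
`E₁ ⊆ E₂`, `F₂ ⊆ F₁` and decreasing `D`:
`(∑_{S : (E₁□F₁ ∨ E₂□F₂) ∧ D} w S) · (∑_{T ⊆ U} w T) ≤ ∑_{(S,T) : ((E₁ S ∧ F₁ T) ∨ (E₂ S ∧ F₂ T)) ∧ D S} w S · w T`. -/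
theorem bk_union_decr_weighted (U : Finset E) (p : E → ℝ) (hp : ∀ i, 0 ≤ p i ∧ p i ≤ 1)
    (E₁ E₂ F₁ F₂ D : Finset E → Prop)
    (hE₁ : Incr E₁) (hE₂ : Incr E₂) (hF₁ : Incr F₁) (hF₂ : Incr F₂) (hD : Decr D)
    (h12 : ∀ S, E₁ S → E₂ S) (h21 : ∀ S, F₂ S → F₁ S) :
    (∑ S ∈ U.powerset.filter (fun S => (DOcc E₁ F₁ S ∨ DOcc E₂ F₂ S) ∧ D S), wt U p S)
        * (∑ T ∈ U.powerset, wt U p T)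
      ≤ ∑ q ∈ (U.powerset ×ˢ U.powerset).filter
          (fun q => ((E₁ q.1 ∧ F₁ q.2) ∨ (E₂ q.1 ∧ F₂ q.2)) ∧ D q.1), wt U p q.1 * wt U p q.2 := by
  -- the left side as a sum over pairs
  have hL : (∑ S ∈ U.powerset.filter (fun S => (DOcc E₁ F₁ S ∨ DOcc E₂ F₂ S) ∧ D S), wt U p S)
        * (∑ T ∈ U.powerset, wt U p T)
      = ∑ q ∈ (U.powerset ×ˢ U.powerset).filter
          (fun q => (DOcc E₁ F₁ q.1 ∨ DOcc E₂ F₂ q.1) ∧ D q.1), wt U p q.1 * wt U p q.2 := by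
    rw [Finset.sum_mul_sum]
    have e : (U.powerset ×ˢ U.powerset).filter
          (fun q => (DOcc E₁ F₁ q.1 ∨ DOcc E₂ F₂ q.1) ∧ D q.1)
        = (U.powerset.filter (fun S => (DOcc E₁ F₁ S ∨ DOcc E₂ F₂ S) ∧ D S)) ×ˢ U.powerset := by
      ext q
      simp only [Finset.mem_filter, Finset.mem_product]
      tauto
    rw [e, Finset.sum_product]
  rw [hL]
  have h1 := sum_pairs_eq_sum_cells U (fun S _ => (DOcc E₁ F₁ S ∨ DOcc E₂ F₂ S) ∧ D S)
    (fun S T => wt U p S * wt U p T)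
  have h2 := sum_pairs_eq_sum_cells U (fun S T => ((E₁ S ∧ F₁ T) ∨ (E₂ S ∧ F₂ T)) ∧ D S)
    (fun S T => wt U p S * wt U p T)
  beta_reduce at h1 h2
  refine le_trans (le_of_eq h1) (le_trans ?_ (le_of_eq h2.symm))
  apply Finset.sum_le_sum
  intro K hK
  apply Finset.sum_le_sum
  intro α hα
  rw [Finset.mem_powerset] at hK hα
  -- on the cell the weight is constant
  set c : ℝ := ∏ i ∈ U, (if i ∈ K then (if i ∈ α then p i else 1 - p i) ^ 2 else p i * (1 - p i))
    with hc
  have hc0 : 0 ≤ c := by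
    rw [hc]
    apply Finset.prod_nonneg
    intro i _
    by_cases hiK : i ∈ K
    · by_cases hiα : i ∈ α
      · simp only [hiK, hiα, if_true]
        exact sq_nonneg _
      · simp only [hiK, hiα, if_true, if_false]
        exact sq_nonneg _
    · simp only [hiK, if_false]
      exact mul_nonneg (hp i).1 (by linarith [(hp i).2])
  have hw : ∀ γ ∈ (U \ K).powerset, wt U p (α ∪ γ) * wt U p (α ∪ ((U \ K) \ γ)) = c := by
    intro γ hγ
    exact wt_cell U K α γ p hα (Finset.mem_powerset.mp hγ)
  have hcard : ((U \ K).powerset.filter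
        (fun γ => (DOcc E₁ F₁ (α ∪ γ) ∨ DOcc E₂ F₂ (α ∪ γ)) ∧ D (α ∪ γ))).card
      ≤ ((U \ K).powerset.filter (fun γ =>
        ((E₁ (α ∪ γ) ∧ F₁ (α ∪ ((U \ K) \ γ))) ∨ (E₂ (α ∪ γ) ∧ F₂ (α ∪ ((U \ K) \ γ))))
          ∧ D (α ∪ γ))).card := by
    calc ((U \ K).powerset.filter
            (fun γ => (DOcc E₁ F₁ (α ∪ γ) ∨ DOcc E₂ F₂ (α ∪ γ)) ∧ D (α ∪ γ))).card
        ≤ ((U \ K).powerset.filter (fun γ =>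
            (DOcc (shift α E₁) (shift α F₁) γ ∨ DOcc (shift α E₂) (shift α F₂) γ)
              ∧ shift α D γ)).card := by
          apply Finset.card_le_card
          intro γ hγ
          simp only [Finset.mem_filter] at hγ ⊢
          refine ⟨hγ.1, ?_, hγ.2.2⟩
          rcases hγ.2.1 with h | h
          · exact Or.inl (dOcc_shift h)
          · exact Or.inr (dOcc_shift h)
      _ ≤ ((U \ K).powerset.filter (fun γ =>
            ((shift α E₁ γ ∧ shift α F₁ ((U \ K) \ γ)) ∨ (shift α E₂ γ ∧ shift α F₂ ((U \ K) \ γ)))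
              ∧ shift α D γ)).card :=
          reimer_union_decr (U \ K) (shift α E₁) (shift α E₂) (shift α F₁) (shift α F₂) (shift α D)
            (incr_shift hE₁ α) (incr_shift hE₂ α) (incr_shift hF₁ α) (incr_shift hF₂ α)
            (decr_shift hD α) (fun S h => h12 _ h) (fun S h => h21 _ h)
      _ = _ := rfl
  rw [Finset.sum_congr rfl (fun γ hγ => hw γ (Finset.mem_of_mem_filter γ hγ)),
    Finset.sum_congr rfl (fun γ hγ => hw γ (Finset.mem_of_mem_filter γ hγ)),
    Finset.sum_const, Finset.sum_const, nsmul_eq_mul, nsmul_eq_mul]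
  apply mul_le_mul_of_nonneg_right _ hc0
  exact_mod_cast hcard


/-- The product weights sum to `1` over `𝒫(U)`. -/
lemma sum_wt (U : Finset E) (p : E → ℝ) : ∑ T ∈ U.powerset, wt U p T = 1 := by
  have h := Finset.prod_add (fun i => p i) (fun i => 1 - p i) U
  have h1 : ∏ i ∈ U, (p i + (1 - p i)) = 1 := by
    apply Finset.prod_eq_one
    intro i _
    ring
  rw [h1] at h
  rw [h]
  apply Finset.sum_congr rfl
  intro T hT
  rw [Finset.mem_powerset] at hT
  unfold wt
  rw [Finset.prod_ite]
  congr 1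
  · apply Finset.prod_congr _ (fun _ _ => rfl)
    ext i
    simp only [Finset.mem_filter]
    exact ⟨fun h => h.2, fun h => ⟨hT h, h⟩⟩
  · apply Finset.prod_congr _ (fun _ _ => rfl)
    ext i
    simp only [Finset.mem_filter, Finset.mem_sdiff]

open Classical in
/-- **Three-point inequality for a root, all edge probabilities (MINE-1 Corollary 16.8).**  With
`P X := ∑_{S ⊆ U, X S} wt U p S` the product-measure probability, for increasing `A`, `B`, `C`
(`A = {s ↔ a}`, `B = {s ↔ b}`, `C = {s ↔ t}`):
`P((A∩C) ∘ B ∪ A ∘ (B∩C)) + P(A∩C)·P(B∩C) ≤ P(A∩C)·P(B) + P(A)·P(B∩C)`. -/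
theorem three_point_weighted (U : Finset E) (p : E → ℝ) (hp : ∀ i, 0 ≤ p i ∧ p i ≤ 1)
    (A B C : Finset E → Prop) (hA : Incr A) (hB : Incr B) (hC : Incr C) :
    (∑ S ∈ U.powerset.filter
        (fun S => DOcc (fun T => A T ∧ C T) B S ∨ DOcc A (fun T => B T ∧ C T) S), wt U p S)
      + (∑ S ∈ U.powerset.filter (fun S => A S ∧ C S), wt U p S)
          * (∑ S ∈ U.powerset.filter (fun S => B S ∧ C S), wt U p S)
      ≤ (∑ S ∈ U.powerset.filter (fun S => A S ∧ C S), wt U p S)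
          * (∑ S ∈ U.powerset.filter B, wt U p S)
        + (∑ S ∈ U.powerset.filter A, wt U p S)
          * (∑ S ∈ U.powerset.filter (fun S => B S ∧ C S), wt U p S) := by
  have hAC : Incr (fun T => A T ∧ C T) := fun _ _ h hx => ⟨hA h hx.1, hC h hx.2⟩
  have hBC : Incr (fun T => B T ∧ C T) := fun _ _ h hx => ⟨hB h hx.1, hC h hx.2⟩
  have h := bk_union_decr_weighted U p hp (fun T => A T ∧ C T) A B (fun T => B T ∧ C T)
    (fun _ => True) hAC hA hB hBC (fun _ _ _ h => h) (fun _ h => h.1) (fun _ h => h.1)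
  rw [sum_wt, mul_one] at h
  set P₁ := U.powerset.filter (fun S => A S ∧ C S) ×ˢ U.powerset.filter B with hP₁
  set P₂ := U.powerset.filter A ×ˢ U.powerset.filter (fun S => B S ∧ C S) with hP₂
  have hI : P₁ ∩ P₂
      = U.powerset.filter (fun S => A S ∧ C S) ×ˢ U.powerset.filter (fun S => B S ∧ C S) := by
    ext q
    simp only [hP₁, hP₂, Finset.mem_filter, Finset.mem_product, Finset.mem_inter]
    tauto
  have hie := Finset.sum_union_inter (s₁ := P₁) (s₂ := P₂) (f := fun q => wt U p q.1 * wt U p q.2)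
  rw [hI] at hie
  have e1 : ∑ q ∈ P₁, wt U p q.1 * wt U p q.2
      = (∑ S ∈ U.powerset.filter (fun S => A S ∧ C S), wt U p S)
          * (∑ S ∈ U.powerset.filter B, wt U p S) := by
    rw [Finset.sum_mul_sum, hP₁, Finset.sum_product]
  have e2 : ∑ q ∈ P₂, wt U p q.1 * wt U p q.2
      = (∑ S ∈ U.powerset.filter A, wt U p S)
          * (∑ S ∈ U.powerset.filter (fun S => B S ∧ C S), wt U p S) := by
    rw [Finset.sum_mul_sum, hP₂, Finset.sum_product]
  have e3 : ∑ q ∈ U.powerset.filter (fun S => A S ∧ C S) ×ˢ U.powerset.filter (fun S => B S ∧ C S),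
        wt U p q.1 * wt U p q.2
      = (∑ S ∈ U.powerset.filter (fun S => A S ∧ C S), wt U p S)
          * (∑ S ∈ U.powerset.filter (fun S => B S ∧ C S), wt U p S) := by
    rw [Finset.sum_mul_sum, Finset.sum_product]
  have key : (∑ S ∈ U.powerset.filter
        (fun S => DOcc (fun T => A T ∧ C T) B S ∨ DOcc A (fun T => B T ∧ C T) S), wt U p S)
      ≤ ∑ q ∈ P₁ ∪ P₂, wt U p q.1 * wt U p q.2 := by
    refine le_trans (le_trans ?_ h) ?_
    · apply Finset.sum_le_sum_of_subset_of_nonneg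
      · intro S hS
        simp only [Finset.mem_filter] at hS ⊢
        exact ⟨hS.1, hS.2, trivial⟩
      · intro S _ _
        exact wt_nonneg U p hp S
    · apply Finset.sum_le_sum_of_subset_of_nonneg
      · intro q hq
        simp only [hP₁, hP₂, Finset.mem_filter, Finset.mem_product, Finset.mem_union] at hq ⊢
        tauto
      · intro q _ _
        exact mul_nonneg (wt_nonneg U p hp _) (wt_nonneg U p hp _)
  linarith [key, hie, e1, e2, e3]

end ReimerCube

end Summit.Ventures.PercRepro2
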